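import Summits.Ventures.LatticeQCDFlow.Exactness.Phi4HMCReversible
import HarnessLib

/-!
# The fluctuation relation of the HMC energy violation: `⟨g(ΔH)⟩ = ⟨g(−ΔH) e^{−ΔH}⟩`, acceptance `= 2·P(ΔH < 0) + P(ΔH = 0)`, and the negative tail `P(ΔH ≤ −c) ≤ e^{−c}`

HONEST FRAMING: exact (Metropolis-corrected) sampling algorithms for lattice gauge theory;
figures of merit are autocorrelation/cost numbers at stated couplings and volumes; no
continuum-physics claim.  (SCALAR calibration rung S0-A: not a gauge result.)

Venture `LatticeQCDFlow` (cell pub-lqcd), topic `Exactness`; FANOUT row 2 (`s0-phi4`: the HMC arm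
of the 2D φ⁴ calibration; the battery's `⟨e^{−ΔH}⟩ = 1` leg X03 and the acceptance columns).  NEW
WORK of the cell over Mathlib; nothing is cited as a fact.  Printed counterparts, named only:
Creutz 1988 (`⟨e^{−ΔH}⟩ = 1`), Gupta–Irbäck–Karsch–Petersson 1990 (`P_acc = erfc(½√⟨ΔH⟩)` and the
sign statistics of `ΔH`), Crooks 1999 / Jarzynski 1997 (fluctuation relations; the tree's
finite-space protocol versions are `Exactness/JarzynskiFinite.lean`, `Exactness/CrooksReversal.lean`,
row 13).

`Scoring/ExpDeltaH.lean` (row 11) proved Creutz's identity from volume preservation alone and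
explained why it cannot see irreversibility.  This file types what the ADDITIONAL structure of
HMC — the proposal `Ψ` is a measure-preserving INVOLUTION — says about the whole LAW of the energy
violation `ΔH = H∘Ψ − H` under the equilibrium weight `e^{−H}`:

## What is proved

* §1 (measure space `(X, μ)`, `Ψ` a measurable `μ`-preserving involution, `H` measurable,
  `deltaH H Ψ = H∘Ψ − H`).  **`integral_comp_deltaH_eq`** — for EVERY `g : ℝ → ℝ`:
  `∫ g(ΔH) e^{−H} dμ = ∫ g(−ΔH) e^{−ΔH} e^{−H} dμ` (substitute `z ↦ Ψ z`: `ΔH∘Ψ = −ΔH`,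
  `e^{−ΔH} e^{−H} = e^{−H∘Ψ}`); `creutz_integral` (`g = 1`: `∫ e^{−ΔH} e^{−H} = ∫ e^{−H}`, Bochner
  form); **`acceptance_integral_eq`** — `e^{−H}` integrable:
  `∫ min(1, e^{−ΔH}) e^{−H} = ∫ 𝟙[ΔH ≤ 0] e^{−H} + ∫ 𝟙[ΔH < 0] e^{−H}` (the equilibrium acceptance
  is `P(ΔH ≤ 0) + P(ΔH < 0) = 2P(ΔH < 0) + P(ΔH = 0)`); **`negative_tail_integral_le`** — for
  every `c`: `∫ 𝟙[ΔH ≤ −c] e^{−H} ≤ e^{−c} ∫ 𝟙[ΔH ≥ c] e^{−H}` (so `P(ΔH ≤ −c) ≤ e^{−c}`: large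
  NEGATIVE violations are exponentially rare in equilibrium, for ANY such proposal).
* §2 (lattice `Fin (n+1) → ℝ`, `H = phi4HmcEnergy J λ`, `Ψ = hmcProposal J λ δ N` — row 2's qpq
  leapfrog trajectory and flip).  `hmc_fluctuation_relation` (every `J`, `λ`, `δ`, `N`, `g`),
  `hmc_creutz`; under a coercive action (`λ > 0`, any `J`): **`hmc_acceptance_eq`** and
  **`hmc_negative_tail_le`**.

Reading for the battery (no new numerics implied): on any HMC row in equilibrium the acceptance
column and the sign statistics of the stored `dH` series must satisfy `acc = 2·frac(dH < 0)` up to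
ties and statistics, and `frac(dH ≤ −c) ≤ e^{−c}` (`c = 5`: at most `0.7 %`); both follow from
exactness-relevant structure (reversibility of the proposal), unlike `⟨e^{−dH}⟩ = 1`, which volume
preservation alone implies.  NOT CLAIMED: the Gaussian law of `ΔH` / the `erfc` formula,
anything about autocorrelations.
-/

namespace Summit.Ventures.LatticeQCDFlow.Exactness

open Real MeasureTheory Finset Filter
open Summit.Ventures.LatticeQCDFlow.Scoring

/-! ## §1 The law of `ΔH` under `e^{−H}` for a measure-preserving involution -/

section General

variable {X : Type*} [MeasurableSpace X] {μ : Measure X}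

/-- The energy violation of the deterministic proposal: `ΔH(z) = H(Ψ z) − H(z)`. -/
def deltaH (H : X → ℝ) (Ψ : X → X) (z : X) : ℝ := H (Ψ z) - H z

omit [MeasurableSpace X] in
/-- Along the involution the violation flips sign: `ΔH(Ψ z) = −ΔH(z)`. -/
theorem deltaH_apply_involutive {H : X → ℝ} {Ψ : X → X} (hΨi : Function.Involutive Ψ) (z : X) :
    deltaH H Ψ (Ψ z) = -deltaH H Ψ z := by
  simp only [deltaH, hΨi z]
  ring

omit [MeasurableSpace X] in
/-- `e^{−ΔH(z)} e^{−H(z)} = e^{−H(Ψ z)}`. -/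
theorem exp_neg_deltaH_mul_exp_neg (H : X → ℝ) (Ψ : X → X) (z : X) :
    Real.exp (-deltaH H Ψ z) * Real.exp (-H z) = Real.exp (-H (Ψ z)) := by
  rw [← Real.exp_add, deltaH]
  congr 1
  ring

omit [MeasurableSpace X] in
/-- The Metropolis test of the proposal is `min(1, e^{−ΔH})` (`= involAccept`). -/
theorem involAccept_eq_min_exp_neg_deltaH (H : X → ℝ) (Ψ : X → X) (z : X) :
    involAccept H Ψ z = min 1 (Real.exp (-deltaH H Ψ z)) := by
  unfold involAccept deltaH
  congr 2
  ring

/-- `ΔH` is measurable. -/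
theorem measurable_deltaH {H : X → ℝ} {Ψ : X → X} (hH : Measurable H) (hΨm : Measurable Ψ) :
    Measurable (deltaH H Ψ) :=
  (hH.comp hΨm).sub hH

/-- **THE FLUCTUATION RELATION OF `ΔH`.**  For a measurable `μ`-preserving involution `Ψ`, a
measurable `H` and EVERY function `g : ℝ → ℝ`:
`∫ g(ΔH) e^{−H} dμ = ∫ g(−ΔH) e^{−ΔH} e^{−H} dμ`. -/
theorem integral_comp_deltaH_eq {H : X → ℝ} {Ψ : X → X} (hΨm : Measurable Ψ)
    (hΨi : Function.Involutive Ψ) (hΨμ : MeasurePreserving Ψ μ μ) (g : ℝ → ℝ) :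
    ∫ z, g (deltaH H Ψ z) * Real.exp (-H z) ∂μ
      = ∫ z, g (-deltaH H Ψ z) * Real.exp (-deltaH H Ψ z) * Real.exp (-H z) ∂μ := by
  have h : ∀ z, g (-deltaH H Ψ z) * Real.exp (-deltaH H Ψ z) * Real.exp (-H z)
      = (fun y => g (deltaH H Ψ y) * Real.exp (-H y)) (Ψ z) := by
    intro z
    simp only
    rw [deltaH_apply_involutive hΨi, mul_assoc, exp_neg_deltaH_mul_exp_neg]
  simp_rw [h]
  exact (hΨμ.integral_comp (MeasurableEquiv.ofInvolutive Ψ hΨi hΨm).measurableEmbedding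
    (fun y => g (deltaH H Ψ y) * Real.exp (-H y))).symm

/-- **Creutz's identity, Bochner form**: `∫ e^{−ΔH} e^{−H} dμ = ∫ e^{−H} dμ` (`g = 1`). -/
theorem creutz_integral {H : X → ℝ} {Ψ : X → X} (hΨm : Measurable Ψ) (hΨi : Function.Involutive Ψ)
    (hΨμ : MeasurePreserving Ψ μ μ) :
    ∫ z, Real.exp (-deltaH H Ψ z) * Real.exp (-H z) ∂μ = ∫ z, Real.exp (-H z) ∂μ := by
  have h := integral_comp_deltaH_eq (H := H) hΨm hΨi hΨμ (fun _ => (1 : ℝ))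
  simp only [one_mul] at h
  exact h.symm

/-- **THE EQUILIBRIUM ACCEPTANCE IS `P(ΔH ≤ 0) + P(ΔH < 0)`** (`= 2P(ΔH < 0) + P(ΔH = 0)`):
`∫ min(1, e^{−ΔH}) e^{−H} dμ = ∫ 𝟙[ΔH ≤ 0] e^{−H} dμ + ∫ 𝟙[ΔH < 0] e^{−H} dμ`. -/
theorem acceptance_integral_eq {H : X → ℝ} {Ψ : X → X} (hH : Measurable H) (hΨm : Measurable Ψ)
    (hΨi : Function.Involutive Ψ) (hΨμ : MeasurePreserving Ψ μ μ)
    (hw : Integrable (fun z => Real.exp (-H z)) μ) :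
    ∫ z, min 1 (Real.exp (-deltaH H Ψ z)) * Real.exp (-H z) ∂μ
      = (∫ z, (if deltaH H Ψ z ≤ 0 then (1 : ℝ) else 0) * Real.exp (-H z) ∂μ)
        + ∫ z, (if deltaH H Ψ z < 0 then (1 : ℝ) else 0) * Real.exp (-H z) ∂μ := by
  have hΔm : Measurable (deltaH H Ψ) := measurable_deltaH hH hΨm
  have hwm : Measurable fun z => Real.exp (-H z) := Real.measurable_exp.comp hH.neg
  have hw0 : ∀ z, 0 ≤ Real.exp (-H z) := fun z => (Real.exp_pos _).le
  -- `min(1, e^{−x}) = 𝟙[x ≤ 0] + e^{−x} 𝟙[x > 0]`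
  have hsplit : ∀ z, min 1 (Real.exp (-deltaH H Ψ z)) * Real.exp (-H z)
      = (if deltaH H Ψ z ≤ 0 then (1 : ℝ) else 0) * Real.exp (-H z)
        + (if 0 < deltaH H Ψ z then (1 : ℝ) else 0) * Real.exp (-deltaH H Ψ z)
          * Real.exp (-H z) := by
    intro z
    by_cases h : deltaH H Ψ z ≤ 0
    · have h1 : (1 : ℝ) ≤ Real.exp (-deltaH H Ψ z) := by
        rw [← Real.exp_zero]
        exact Real.exp_le_exp.mpr (by linarith)
      rw [min_eq_left h1, if_pos h, if_neg (not_lt.mpr h)]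
      ring
    · rw [not_le] at h
      have h1 : Real.exp (-deltaH H Ψ z) ≤ 1 := by
        rw [← Real.exp_zero]
        exact Real.exp_le_exp.mpr (by linarith)
      rw [min_eq_right h1, if_neg (not_le.mpr h), if_pos h]
      ring
  -- the fluctuation relation turns `e^{−ΔH} 𝟙[ΔH > 0]` into `𝟙[ΔH < 0]`
  have hrel := integral_comp_deltaH_eq (H := H) hΨm hΨi hΨμ (fun x => if x < 0 then (1 : ℝ) else 0)
  have hrel' : ∫ z, (if 0 < deltaH H Ψ z then (1 : ℝ) else 0) * Real.exp (-deltaH H Ψ z)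
      * Real.exp (-H z) ∂μ = ∫ z, (if deltaH H Ψ z < 0 then (1 : ℝ) else 0) * Real.exp (-H z) ∂μ := by
    rw [hrel]
    refine integral_congr_ae (Eventually.of_forall fun z => ?_)
    simp only [neg_lt_zero]
  -- integrability of the two pieces
  have hind_le : Measurable fun z => if deltaH H Ψ z ≤ 0 then (1 : ℝ) else 0 :=
    Measurable.ite (measurableSet_le hΔm measurable_const) measurable_const measurable_const
  have hind_gt : Measurable fun z => if 0 < deltaH H Ψ z then (1 : ℝ) else 0 :=
    Measurable.ite (measurableSet_lt measurable_const hΔm) measurable_const measurable_const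
  have hI1 : Integrable (fun z => (if deltaH H Ψ z ≤ 0 then (1 : ℝ) else 0) * Real.exp (-H z)) μ := by
    refine integrable_bdd_mul_weight hind_le (C := 1) (fun z => ?_) hwm hw0 hw
    split_ifs <;> simp
  have hI2 : Integrable (fun z => (if 0 < deltaH H Ψ z then (1 : ℝ) else 0)
      * Real.exp (-deltaH H Ψ z) * Real.exp (-H z)) μ := by
    refine integrable_bdd_mul_weight (hind_gt.mul (Real.measurable_exp.comp hΔm.neg)) (C := 1)
      (fun z => ?_) hwm hw0 hw
    split_ifs with h
    · have h1 : Real.exp (-deltaH H Ψ z) ≤ 1 := by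
        rw [← Real.exp_zero]
        exact Real.exp_le_exp.mpr (by linarith)
      rw [one_mul, abs_of_pos (Real.exp_pos _)]
      exact h1
    · simp
  simp_rw [hsplit]
  rw [integral_add hI1 hI2, hrel']

/-- **THE NEGATIVE TAIL IS EXPONENTIALLY SMALL**: for every `c`,
`∫ 𝟙[ΔH ≤ −c] e^{−H} dμ ≤ e^{−c} ∫ 𝟙[ΔH ≥ c] e^{−H} dμ` — in equilibrium `P(ΔH ≤ −c) ≤ e^{−c}`,
whatever the (measure-preserving, involutive) proposal. -/
theorem negative_tail_integral_le {H : X → ℝ} {Ψ : X → X} (hH : Measurable H) (hΨm : Measurable Ψ)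
    (hΨi : Function.Involutive Ψ) (hΨμ : MeasurePreserving Ψ μ μ)
    (hw : Integrable (fun z => Real.exp (-H z)) μ) (c : ℝ) :
    ∫ z, (if deltaH H Ψ z ≤ -c then (1 : ℝ) else 0) * Real.exp (-H z) ∂μ
      ≤ Real.exp (-c) * ∫ z, (if c ≤ deltaH H Ψ z then (1 : ℝ) else 0) * Real.exp (-H z) ∂μ := by
  have hΔm : Measurable (deltaH H Ψ) := measurable_deltaH hH hΨm
  have hwm : Measurable fun z => Real.exp (-H z) := Real.measurable_exp.comp hH.neg
  have hw0 : ∀ z, 0 ≤ Real.exp (-H z) := fun z => (Real.exp_pos _).le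
  -- the relation with `g = 𝟙[· ≥ c]`
  have hrel := integral_comp_deltaH_eq (H := H) hΨm hΨi hΨμ (fun x => if c ≤ x then (1 : ℝ) else 0)
  have hrel' : ∫ z, (if c ≤ deltaH H Ψ z then (1 : ℝ) else 0) * Real.exp (-H z) ∂μ
      = ∫ z, (if deltaH H Ψ z ≤ -c then (1 : ℝ) else 0) * Real.exp (-deltaH H Ψ z)
          * Real.exp (-H z) ∂μ := by
    rw [hrel]
    refine integral_congr_ae (Eventually.of_forall fun z => ?_)
    simp only [le_neg]
  -- integrability
  have hind : Measurable fun z => if deltaH H Ψ z ≤ -c then (1 : ℝ) else 0 :=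
    Measurable.ite (measurableSet_le hΔm measurable_const) measurable_const measurable_const
  have hind' : Measurable fun z => if c ≤ deltaH H Ψ z then (1 : ℝ) else 0 :=
    Measurable.ite (measurableSet_le measurable_const hΔm) measurable_const measurable_const
  have hI1 : Integrable (fun z => (if deltaH H Ψ z ≤ -c then (1 : ℝ) else 0) * Real.exp (-H z)) μ := by
    refine integrable_bdd_mul_weight hind (C := 1) (fun z => ?_) hwm hw0 hw
    split_ifs <;> simp
  have hI0 : Integrable (fun z => (if c ≤ deltaH H Ψ z then (1 : ℝ) else 0) * Real.exp (-H z)) μ := by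
    refine integrable_bdd_mul_weight hind' (C := 1) (fun z => ?_) hwm hw0 hw
    split_ifs <;> simp
  have hI2 : Integrable (fun z => (if deltaH H Ψ z ≤ -c then (1 : ℝ) else 0)
      * Real.exp (-deltaH H Ψ z) * Real.exp (-H z)) μ := by
    -- it is `(𝟙[ΔH ≥ c] e^{−H}) ∘ Ψ`
    have h := (hΨμ.integrable_comp hI0.aestronglyMeasurable).mpr hI0
    refine h.congr (Eventually.of_forall fun z => ?_)
    simp only [Function.comp_apply]
    rw [deltaH_apply_involutive hΨi, mul_assoc, exp_neg_deltaH_mul_exp_neg]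
    simp only [le_neg]
  -- pointwise: on `{ΔH ≤ −c}`, `e^{c} ≤ e^{−ΔH}`
  have hpt : ∀ z, Real.exp c * ((if deltaH H Ψ z ≤ -c then (1 : ℝ) else 0) * Real.exp (-H z))
      ≤ (if deltaH H Ψ z ≤ -c then (1 : ℝ) else 0) * Real.exp (-deltaH H Ψ z) * Real.exp (-H z) := by
    intro z
    split_ifs with h
    · have h1 : Real.exp c ≤ Real.exp (-deltaH H Ψ z) := Real.exp_le_exp.mpr (by linarith)
      rw [one_mul, one_mul]
      exact mul_le_mul_of_nonneg_right h1 (hw0 z)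
    · simp
  have hmono := integral_mono (hI1.const_mul (Real.exp c)) hI2 hpt
  rw [integral_const_mul, ← hrel'] at hmono
  -- divide by `e^{c}`
  have hc : 0 < Real.exp c := Real.exp_pos c
  have h2 : ∫ z, (if deltaH H Ψ z ≤ -c then (1 : ℝ) else 0) * Real.exp (-H z) ∂μ
      ≤ (∫ z, (if c ≤ deltaH H Ψ z then (1 : ℝ) else 0) * Real.exp (-H z) ∂μ) / Real.exp c :=
    (le_div_iff₀' hc).mpr hmono
  calc ∫ z, (if deltaH H Ψ z ≤ -c then (1 : ℝ) else 0) * Real.exp (-H z) ∂μ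
      ≤ (∫ z, (if c ≤ deltaH H Ψ z then (1 : ℝ) else 0) * Real.exp (-H z) ∂μ) / Real.exp c := h2
    _ = Real.exp (-c) * ∫ z, (if c ≤ deltaH H Ψ z then (1 : ℝ) else 0) * Real.exp (-H z) ∂μ := by
        rw [Real.exp_neg, div_eq_inv_mul]

end General

/-! ## §2 The lattice: row 2's HMC trajectory -/

section Lattice

variable {n : ℕ}

/-- The energy violation of one HMC update: `ΔH = H(Ψ(φ,p)) − H(φ,p)`, `Ψ` = `N` qpq leapfrog
steps of size `δ` and the flip. -/
noncomputable def hmcDeltaH (J : Fin (n + 1) → Fin (n + 1) → ℝ) (lam δ : ℝ) (N : ℕ)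
    (z : (Fin (n + 1) → ℝ) × (Fin (n + 1) → ℝ)) : ℝ :=
  deltaH (phi4HmcEnergy J lam) (hmcProposal J lam δ N) z

/-- **The fluctuation relation for row 2's HMC**, every `J`, `λ`, `δ`, `N`, every `g`:
`∫ g(ΔH) e^{−H} = ∫ g(−ΔH) e^{−ΔH} e^{−H}` over phase space. -/
theorem hmc_fluctuation_relation (J : Fin (n + 1) → Fin (n + 1) → ℝ) (lam δ : ℝ) (N : ℕ)
    (g : ℝ → ℝ) :
    ∫ z, g (hmcDeltaH J lam δ N z) * Real.exp (-phi4HmcEnergy J lam z)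
        ∂((volume : Measure (Fin (n + 1) → ℝ)).prod volume)
      = ∫ z, g (-hmcDeltaH J lam δ N z) * Real.exp (-hmcDeltaH J lam δ N z)
          * Real.exp (-phi4HmcEnergy J lam z) ∂((volume : Measure (Fin (n + 1) → ℝ)).prod volume) :=
  integral_comp_deltaH_eq (measurable_hmcProposal J lam δ N) (hmcProposal_involutive J lam δ N)
    (measurePreserving_hmcProposal J lam δ N) g

/-- **Creutz for row 2's HMC** (Bochner form): `∫ e^{−ΔH} e^{−H} = ∫ e^{−H}`, every `J`, `λ`, `δ`, `N`. -/
theorem hmc_creutz (J : Fin (n + 1) → Fin (n + 1) → ℝ) (lam δ : ℝ) (N : ℕ) :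
    ∫ z, Real.exp (-hmcDeltaH J lam δ N z) * Real.exp (-phi4HmcEnergy J lam z)
        ∂((volume : Measure (Fin (n + 1) → ℝ)).prod volume)
      = ∫ z, Real.exp (-phi4HmcEnergy J lam z)
          ∂((volume : Measure (Fin (n + 1) → ℝ)).prod volume) :=
  creutz_integral (measurable_hmcProposal J lam δ N) (hmcProposal_involutive J lam δ N)
    (measurePreserving_hmcProposal J lam δ N)

/-- **Equilibrium acceptance of row 2's HMC = `P(ΔH ≤ 0) + P(ΔH < 0)`** (coercive action, every
`δ`, `N`): `∫ min(1, e^{−ΔH}) e^{−H} = ∫ 𝟙[ΔH ≤ 0] e^{−H} + ∫ 𝟙[ΔH < 0] e^{−H}`. -/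
theorem hmc_acceptance_eq {J : Fin (n + 1) → Fin (n + 1) → ℝ} {lam ε K : ℝ} (hε : 0 < ε)
    (hS : ∀ φ : Fin (n + 1) → ℝ, ε * ∑ w, φ w ^ 2 - K ≤ latticePhi4Action J lam φ)
    (δ : ℝ) (N : ℕ) :
    ∫ z, min 1 (Real.exp (-hmcDeltaH J lam δ N z)) * Real.exp (-phi4HmcEnergy J lam z)
        ∂((volume : Measure (Fin (n + 1) → ℝ)).prod volume)
      = (∫ z, (if hmcDeltaH J lam δ N z ≤ 0 then (1 : ℝ) else 0) * Real.exp (-phi4HmcEnergy J lam z)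
          ∂((volume : Measure (Fin (n + 1) → ℝ)).prod volume))
        + ∫ z, (if hmcDeltaH J lam δ N z < 0 then (1 : ℝ) else 0) * Real.exp (-phi4HmcEnergy J lam z)
          ∂((volume : Measure (Fin (n + 1) → ℝ)).prod volume) :=
  acceptance_integral_eq (measurable_phi4HmcEnergy J lam) (measurable_hmcProposal J lam δ N)
    (hmcProposal_involutive J lam δ N) (measurePreserving_hmcProposal J lam δ N)
    (integrable_exp_neg_phi4HmcEnergy hε hS)

/-- **Negative energy violations are exponentially rare for row 2's HMC in equilibrium**
(coercive action, every `δ`, `N`, `c`): `∫ 𝟙[ΔH ≤ −c] e^{−H} ≤ e^{−c} ∫ 𝟙[ΔH ≥ c] e^{−H}`. -/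
theorem hmc_negative_tail_le {J : Fin (n + 1) → Fin (n + 1) → ℝ} {lam ε K : ℝ} (hε : 0 < ε)
    (hS : ∀ φ : Fin (n + 1) → ℝ, ε * ∑ w, φ w ^ 2 - K ≤ latticePhi4Action J lam φ)
    (δ : ℝ) (N : ℕ) (c : ℝ) :
    ∫ z, (if hmcDeltaH J lam δ N z ≤ -c then (1 : ℝ) else 0) * Real.exp (-phi4HmcEnergy J lam z)
        ∂((volume : Measure (Fin (n + 1) → ℝ)).prod volume)
      ≤ Real.exp (-c) * ∫ z, (if c ≤ hmcDeltaH J lam δ N z then (1 : ℝ) else 0)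
          * Real.exp (-phi4HmcEnergy J lam z) ∂((volume : Measure (Fin (n + 1) → ℝ)).prod volume) :=
  negative_tail_integral_le (measurable_phi4HmcEnergy J lam) (measurable_hmcProposal J lam δ N)
    (hmcProposal_involutive J lam δ N) (measurePreserving_hmcProposal J lam δ N)
    (integrable_exp_neg_phi4HmcEnergy hε hS) c

end Lattice

end Summit.Ventures.LatticeQCDFlow.Exactness
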